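import Mathlib
import HarnessLib
import Summits.HubbardSuperconductivity.HubbardSuperconductivity.Theorems.KLProgrammeKLRegimeEngineScaleZeroTransfer
import Summits.HubbardSuperconductivity.HubbardSuperconductivity.Theorems.KLProgrammeKLRegimeEngineV8PairTransferExport8
import Summits.HubbardSuperconductivity.HubbardSuperconductivity.Theorems.KLProgrammeKLRegimeEngineV8PairTransferRelBarIdx
import Literature.Probability.LatticeModels.BoxSineHarmonic

/-!
# Route `KLProgramme` — ENGINE item stmt-HubbardSuperconductivity-20437 `KLRegimeEngineV17F2`, row (X) conjunct (X).2′ (class #5 «95v2»): THE SCALE-0 BASE ROW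
# PRICED AGAINST THE TREE'S SCALE-0 CONSTANTS — **`klScaleZeroA0_ge_two_pow`**, **`klScaleZeroCV_ge_two_pow`**, **`klTransferC_ge_two_pow`** (`klTransferC R ≥ 2¹⁰²`),
# **`klmx_base_scalar_room`** (the BASE scalar inequality forces `klCTcap8·Klam² ≥ 2⁹³`), **`klmx_base_scalar_false_of_lt`** (kernel witness of the located item)
# (cell gate-hubbard-kl, seat hubbard-kl-k3c1-p1 g23; located item «(X).2′-BASE-ROOM» — a DISCHARGEABILITY reading of one class-#5 producer row, nothing landed is false)

WHY.  The class-#5 one-call «95v2» (✓ p698479; read BY TYPE in `A24a1G14.stub_engine_exports_of_class5Rows(Cap)(Grid)`, ✓ p729777 / p730811) carries, in its scale-0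
BASE package `hbase`, ONE scalar inequality of the depth `j′` (the budget of the scale-0 transfer, `klmf_baseData_of_scaleZero`, k3c1-p1 g14 row 52b):
  `(4/6047)·klIdxMass 0 j′·(klTransferC R·U²) + 4·(mA U)²·klIdxMass 0 j′ ≤ θ·(r·((Klam·U)²·klIdxMass 0 j′))`
with the class-#5 data constrained by `θ ≤ 1/5` (`hθ`) and `r ≤ klCTcap8 = 2²⁰·(1 + klTS)` (`hrc`, `klCTcap8_eq`).  The inequality is HOMOGENEOUS in `U²` and in
`klIdxMass 0 j′ > 0`, so smallness of `U` cannot help: it forces `(4/6047)·klTransferC R ≤ klCTcap8·Klam²/5`.  Here `klTransferC R` is k3c2-p1 g5's EXPLICIT scale-0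
transfer constant `40960·e·6047·CV·ΘC/κ₀⁶`, `ΘC = e·A₀·CV/κ₀²`, `κ₀² = 12108`, `CV = (2e²κ₀)²·κF(R) + (2e²κ₀)⁴ ≥ (2e²κ₀)⁴`, `A₀ = klScaleZeroA0` (the determinant-bound decay
constant at `klE0 = 1/32`).  This file proves, in the kernel, `A₀ ≥ 2⁴²`, `CV ≥ 2⁴²`, hence `klTransferC R ≥ 2¹⁰²` for EVERY `R` with `0 ≤ R.Gfr 0`, and therefore:
* **`klmx_base_scalar_room`** — if the BASE scalar inequality holds at SOME `U > 0`, `j′`, `mA`, with `0 ≤ θ ≤ 1/5`, `r ≤ klCTcap8`, then `2⁹³ ≤ klCTcap8·Klam²`,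
  i.e. `2⁷³ ≤ (1 + klTS)·Klam²` (`klmx_base_scalar_room_klTS`);
* **`klmx_base_scalar_false_of_lt`** — contrapositive: for `klCTcap8·Klam² < 2⁹³` the BASE scalar row is FALSE at every `U > 0`, every `j′`, every envelope `mA`.
LOCATED «(X).2′-BASE-ROOM» (dischargeability, not falsity of anything landed): row (X) is registered under `∀ P, P.WF → ∀ R, R.WF2 → …` with `P.WF ⇒ 1 ≤ Klam` only, and
`klTS = klTwoShellPack.1` is an opaque `Classical.choose` value with provable floor `0`; so for every admissible `P` with `Klam² < 2⁷³/(1 + klTS)` (in particular no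
proof can exclude `Klam = 1`) NO supplier can discharge `hbase` of «95v2» as typed — the scale-0 transfer constant of record (`≈ 2.9·10³¹`) does not fit the `r`-capped
(X).3 ROOM (`θ·r·Klam² ≤ 2²⁰(1+klTS)Klam²/5`).  Cures (for the pen, not asserted here): (α) an `(P,R)`-dependent cap in the transfer package (registry text
`IsTransferPkg8`, frozen — motion after KILL), (β) a scale-0 transfer theorem with a constant `≤ 2¹⁵·Klam²` (26 orders below the determinant-bound constant), (γ) re-keying the
BASE budget to an `r`-free slot.  Pure real arithmetic on landed definitions; nothing asserts or refutes (X), any stub of 20437, K3, U₀, the window or superconductivity.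
0 kit · 0 lit.  References: BGM 2006 §2.4, §3 [cite: BenfattoGiulianiMastropietro2006].
-/

noncomputable section

namespace Summit.HubbardSuperconductivity.HubbardSuperconductivity.Theorems.KLRegimeSplit

set_option linter.dupNamespace false -- summit = problem name (single-conjunct summit), D-0017

open Real
open Summit.HubbardSuperconductivity.HubbardSuperconductivity.Theorems.EngineV8

/-! ## §1 Kernel lower bounds of the scale-0 constants -/

section Constants

/-- `e² ≥ 7`. -/
theorem klmr_seven_le_exp_two : (7 : ℝ) ≤ Real.exp 2 := by
  have h := Real.exp_one_gt_d9
  have h2 : Real.exp 2 = Real.exp 1 * Real.exp 1 := by rw [← Real.exp_add]; norm_num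
  rw [h2]; nlinarith [Real.exp_pos 1]

/-- `κ₀ = √12108 ≥ 110`. -/
theorem klmr_kappa0_ge : (110 : ℝ) ≤ Real.sqrt (2 * (7 + 6047)) :=
  Real.le_sqrt_of_sq_le (by norm_num)

/-- `κ₀² = 12108`. -/
theorem klmr_kappa0_sq : Real.sqrt (2 * (7 + 6047)) ^ 2 = 12108 := by
  rw [Real.sq_sqrt (by norm_num)]; norm_num

/-- **`klScaleZeroCV_ge_two_pow`** — `CV(R) ≥ (2e²κ₀)⁴ ≥ 2⁴²` for `0 ≤ R.Gfr 0`. -/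
theorem klScaleZeroCV_ge_two_pow {R : RenConsts} (hR : 0 ≤ R.Gfr 0) : (2 : ℝ) ^ 42 ≤ klScaleZeroCV R := by
  unfold klScaleZeroCV
  have hk := (klKappaFrameC_pos hR).le
  have h1 : (1540 : ℝ) ≤ 2 * Real.exp 2 * Real.sqrt (2 * (7 + 6047)) := by
    have he := klmr_seven_le_exp_two
    have hκ := klmr_kappa0_ge
    nlinarith [Real.exp_pos 2, Real.sqrt_nonneg (2 * (7 + 6047))]
  have h4 : (1540 : ℝ) ^ 4 ≤ (2 * Real.exp 2 * Real.sqrt (2 * (7 + 6047))) ^ 4 := pow_le_pow_left₀ (by norm_num) h1 4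
  have hsq : 0 ≤ (2 * Real.exp 2 * Real.sqrt (2 * (7 + 6047))) ^ 2 * klKappaFrameC R := by positivity
  have hnum : (2 : ℝ) ^ 42 ≤ (1540 : ℝ) ^ 4 := by norm_num
  linarith

/-- **`klScaleZeroA0_ge_two_pow`** — `A₀ ≥ 2⁴²` (keep only the last term under the root: `π⁴ ≥ 81`, `klE0 = 1/32`). -/
theorem klScaleZeroA0_ge_two_pow : (2 : ℝ) ^ 42 ≤ klScaleZeroA0 := by
  unfold klScaleZeroA0
  have he : klE0 = 1 / 32 := by norm_num [klE0]
  have hπ := Real.pi_gt_three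
  have hπ4 : (81 : ℝ) ≤ Real.pi ^ 4 := by
    have h := pow_le_pow_left₀ (by norm_num : (0 : ℝ) ≤ 3) hπ.le 4
    norm_num at h; linarith
  set c : ℝ := 4 * (1110 : ℝ) + 6 * (32 / 3) + 2 with hc
  have hcv : c = 4506 := by rw [hc]; norm_num
  -- the inner sum is at least its last term
  have hA1 : 0 ≤ 2 / klE0 := by rw [he]; norm_num
  have hA2 : 0 ≤ 128 * Real.pi ^ 4 * c ^ 2 / klE0 := by rw [he]; positivity
  have hA3 : 0 ≤ 2 * Real.pi ^ 5 * c ^ 2 / klE0 ^ 2 := by rw [he]; positivity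
  have hlast : (81 : ℝ) * 14130816 ^ 2 * 32768 ≤ Real.pi ^ 4 * ((7 : ℝ) ^ 2 * c * (2 / klE0) + 7 * (2 * (32 / 3) + 1)) ^ 2 / klE0 ^ 3 := by
    rw [he, hcv]
    have hsq : (14130816 : ℝ) ^ 2 ≤ ((7 : ℝ) ^ 2 * 4506 * (2 / (1 / 32)) + 7 * (2 * (32 / 3) + 1)) ^ 2 := by
      apply pow_le_pow_left₀ (by norm_num); norm_num
    have h3 : ((1 : ℝ) / 32) ^ 3 = 1 / 32768 := by norm_num
    rw [h3, div_div_eq_mul_div, div_one]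
    nlinarith [hπ4, hsq]
  have hinner : (81 : ℝ) * 14130816 ^ 2 * 32768 ≤ 2 / klE0 + 128 * Real.pi ^ 4 * c ^ 2 / klE0 + 2 * Real.pi ^ 5 * c ^ 2 / klE0 ^ 2 + 1 +
      Real.pi ^ 4 * ((7 : ℝ) ^ 2 * c * (2 / klE0) + 7 * (2 * (32 / 3) + 1)) ^ 2 / klE0 ^ 3 := by linarith
  have hfac : (1 : ℝ) / 2 + 12 / klE0 = 769 / 2 := by rw [he]; norm_num
  have hX : ((2 : ℝ) ^ 42 / 14) ^ 2 ≤ (1 / 2 + 12 / klE0) * (2 / klE0 + 128 * Real.pi ^ 4 * c ^ 2 / klE0 + 2 * Real.pi ^ 5 * c ^ 2 / klE0 ^ 2 + 1 +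
      Real.pi ^ 4 * ((7 : ℝ) ^ 2 * c * (2 / klE0) + 7 * (2 * (32 / 3) + 1)) ^ 2 / klE0 ^ 3) := by
    rw [hfac]
    have hnum : ((2 : ℝ) ^ 42 / 14) ^ 2 ≤ 769 / 2 * ((81 : ℝ) * 14130816 ^ 2 * 32768) := by norm_num
    nlinarith
  have hroot := Real.le_sqrt_of_sq_le hX
  have h14 : (2 : ℝ) ^ 42 = 14 * ((2 : ℝ) ^ 42 / 14) := by ring
  rw [h14]
  exact mul_le_mul_of_nonneg_left hroot (by norm_num)

/-- **`klTransferC_eq_closed`** — `klTransferC R = 40960·6047·e²·A₀·CV²/12108⁴`. -/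
theorem klTransferC_eq_closed (R : RenConsts) :
    klTransferC R = 40960 * 6047 * Real.exp 1 ^ 2 * klScaleZeroA0 * klScaleZeroCV R ^ 2 / 12108 ^ 4 := by
  unfold klTransferC klScaleZeroThetaC
  have h2 := klmr_kappa0_sq
  have h6 : Real.sqrt (2 * (7 + 6047)) ^ 6 = 12108 ^ 3 := by rw [← h2]; ring
  rw [h6, h2]
  field_simp

/-- **`klTransferC_ge_two_pow`** — THE SCALE-0 TRANSFER CONSTANT OF RECORD IS AT LEAST `2¹⁰²` for every `R` with `0 ≤ R.Gfr 0`. -/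
theorem klTransferC_ge_two_pow {R : RenConsts} (hR : 0 ≤ R.Gfr 0) : (2 : ℝ) ^ 102 ≤ klTransferC R := by
  rw [klTransferC_eq_closed]
  have hA := klScaleZeroA0_ge_two_pow
  have hC := klScaleZeroCV_ge_two_pow hR
  have hE : (27 / 10 : ℝ) ^ 2 ≤ Real.exp 1 ^ 2 := pow_le_pow_left₀ (by norm_num) Literature.Probability.LatticeModels.exp_one_ge 2
  have hC2 : ((2 : ℝ) ^ 42) ^ 2 ≤ klScaleZeroCV R ^ 2 := pow_le_pow_left₀ (by norm_num) hC 2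
  have hprod : (27 / 10 : ℝ) ^ 2 * (2 : ℝ) ^ 42 * ((2 : ℝ) ^ 42) ^ 2 ≤ Real.exp 1 ^ 2 * klScaleZeroA0 * klScaleZeroCV R ^ 2 := by
    have h1 : (27 / 10 : ℝ) ^ 2 * (2 : ℝ) ^ 42 ≤ Real.exp 1 ^ 2 * klScaleZeroA0 :=
      mul_le_mul hE hA (by norm_num) (by positivity)
    exact mul_le_mul h1 hC2 (by positivity) (by positivity)
  rw [le_div_iff₀ (by norm_num)]
  have hnum : (2 : ℝ) ^ 102 * 12108 ^ 4 ≤ 40960 * 6047 * ((27 / 10 : ℝ) ^ 2 * (2 : ℝ) ^ 42 * ((2 : ℝ) ^ 42) ^ 2) := by norm_num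
  nlinarith

end Constants

/-! ## §2 The BASE scalar row forces `klCTcap8·Klam² ≥ 2⁹³` -/

section Room

/-- **`klmx_base_scalar_room`** — if the scale-0 BASE scalar inequality of «95v2»'s `hbase` holds at some `U > 0`, depth `j′` and envelope value `m`, with the class-#5
data in their doors (`0 ≤ θ ≤ 1/5`, `r ≤ klCTcap8`) and `0 ≤ R.Gfr 0`, then `2⁹³ ≤ klCTcap8·Klam²`. -/
theorem klmx_base_scalar_room {P : SplitConsts} {R : RenConsts} (hR : 0 ≤ R.Gfr 0) {U θ r m : ℝ} (hU : 0 < U)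
    (hθ0 : 0 ≤ θ) (hθ : θ ≤ 1 / 5) (hrc : r ≤ klCTcap8) {j' : ℕ}
    (h : 4 / 6047 * klIdxMass 0 j' * (klTransferC R * U ^ 2) + 4 * (m * m) * klIdxMass 0 j' ≤ θ * (r * ((P.Klam * U) ^ 2 * klIdxMass 0 j'))) :
    (2 : ℝ) ^ 93 ≤ klCTcap8 * P.Klam ^ 2 := by
  have hms : 0 < klIdxMass 0 j' := by unfold klIdxMass; positivity
  have hT := klTransferC_ge_two_pow hR
  have hTpos : 0 < klTransferC R := lt_of_lt_of_le (by positivity) hT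
  have hmm : 0 ≤ 4 * (m * m) * klIdxMass 0 j' := by nlinarith [mul_self_nonneg m]
  -- drop the Neumann term and cancel `U²·ms > 0`
  have h1 : 4 / 6047 * klTransferC R * (U ^ 2 * klIdxMass 0 j') ≤ θ * r * P.Klam ^ 2 * (U ^ 2 * klIdxMass 0 j') := by nlinarith
  have hpos : 0 < U ^ 2 * klIdxMass 0 j' := by positivity
  have h2 : 4 / 6047 * klTransferC R ≤ θ * r * P.Klam ^ 2 := le_of_mul_le_mul_right h1 hpos
  -- `θ·r ≤ klCTcap8/5` (the left side is positive, so `r > 0` when `Klam ≠ 0`; when `θ·r·Klam² = 0` the row is absurd)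
  have hlhs : 0 < 4 / 6047 * klTransferC R := by positivity
  have hθr : θ * r * P.Klam ^ 2 ≤ 1 / 5 * klCTcap8 * P.Klam ^ 2 := by
    have hK2 : 0 ≤ P.Klam ^ 2 := sq_nonneg _
    by_cases hr0 : 0 ≤ r
    · exact mul_le_mul_of_nonneg_right (mul_le_mul hθ hrc hr0 (by norm_num)) hK2
    · have hr0' : r ≤ 0 := (lt_of_not_ge hr0).le
      have hθr0 : θ * r ≤ 0 := mul_nonpos_of_nonneg_of_nonpos hθ0 hr0'
      have h0 : θ * r * P.Klam ^ 2 ≤ 0 := mul_nonpos_of_nonpos_of_nonneg hθr0 hK2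
      have hc : 0 ≤ 1 / 5 * klCTcap8 * P.Klam ^ 2 := by have := klCTcap8_pos; positivity
      linarith
  have h3 : 4 / 6047 * (2 : ℝ) ^ 102 ≤ 1 / 5 * klCTcap8 * P.Klam ^ 2 := by nlinarith
  nlinarith

/-- **`klmx_base_scalar_room_klTS`** — the same as a condition on the opaque two-shell constant: `2⁷³ ≤ (1 + klTS)·Klam²`. -/
theorem klmx_base_scalar_room_klTS {P : SplitConsts} {R : RenConsts} (hR : 0 ≤ R.Gfr 0) {U θ r m : ℝ} (hU : 0 < U)
    (hθ0 : 0 ≤ θ) (hθ : θ ≤ 1 / 5) (hrc : r ≤ klCTcap8) {j' : ℕ}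
    (h : 4 / 6047 * klIdxMass 0 j' * (klTransferC R * U ^ 2) + 4 * (m * m) * klIdxMass 0 j' ≤ θ * (r * ((P.Klam * U) ^ 2 * klIdxMass 0 j'))) :
    (2 : ℝ) ^ 73 ≤ (1 + klTS) * P.Klam ^ 2 := by
  have h93 := klmx_base_scalar_room hR hU hθ0 hθ hrc h
  rw [klCTcap8_eq] at h93
  nlinarith [sq_nonneg P.Klam, klTS_nonneg]

/-- **`klmx_base_scalar_false_of_lt`** — KERNEL WITNESS of the located item «(X).2′-BASE-ROOM»: whenever `klCTcap8·Klam² < 2⁹³` (e.g. `Klam = 1` unless the opaque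
`klTS ≥ 2⁷³ − 1`), the BASE scalar row of «95v2» is false at EVERY `U > 0`, every depth `j′`, every envelope value, for all admissible class-#5 data `θ ≤ 1/5`,
`r ≤ klCTcap8`. -/
theorem klmx_base_scalar_false_of_lt {P : SplitConsts} {R : RenConsts} (hR : 0 ≤ R.Gfr 0)
    (hsmall : klCTcap8 * P.Klam ^ 2 < (2 : ℝ) ^ 93) {U θ r m : ℝ} (hU : 0 < U) (hθ0 : 0 ≤ θ) (hθ : θ ≤ 1 / 5) (hrc : r ≤ klCTcap8) (j' : ℕ) :
    ¬ (4 / 6047 * klIdxMass 0 j' * (klTransferC R * U ^ 2) + 4 * (m * m) * klIdxMass 0 j' ≤ θ * (r * ((P.Klam * U) ^ 2 * klIdxMass 0 j'))) :=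
  fun h => (not_le.mpr hsmall) (klmx_base_scalar_room hR hU hθ0 hθ hrc h)

end Room

end Summit.HubbardSuperconductivity.HubbardSuperconductivity.Theorems.KLRegimeSplit

end
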